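import Literature.NumberTheory.EllipticCurves.TateModuleDeterminantProofs
import Literature.NumberTheory.EllipticCurves.IsogenyFrobeniusTraceProofs
import Literature.NumberTheory.EllipticCurves.GaloisActionProofs
import Mathlib.LinearAlgebra.Trace
import HarnessLib

/-!
# Density `0` of the supersingular primes (Serre) — proofs, part 3: the trace of Frobenius on
# `E[ℓ]` is `a_p mod ℓ`

Third `…Proofs` file (theorems only, nothing is defined) of the series working towards the named
fact `WeierstrassCurve.serre_supersingular_density_zero` of
`Literature.NumberTheory.EllipticCurves.SupersingularDensity` (Serre 1981, §8, Thm. 20 / Cor. 2);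
parts 1–2 are `SupersingularDensitySerreProofs` (density calculus, `GL₂(𝔽_q)` count) and
`SupersingularDensitySerreFrobeniusProofs` (Hasse, Serre's set).

Serre, *Publ. Math. IHÉS* 54 (1981), §8.1, eq. (238) (p. 188): for the mod-`n` representation
`φ_n : Gal(ℚ̄/ℚ) → Aut(E_n) ≅ GL₂(ℤ/nℤ)` and `p ∤ n N_E`, `Tr φ_n(σ_p) ≡ a_p (mod n)`.  This file
proves the case `n = ℓ` prime for the tree's `ρ̄_{E,ℓ} = WeierstrassCurve.galoisRepTorsion W ℓ`
(`GaloisAction`), reading `E[ℓ]` as an `𝔽_ℓ`-plane through Mathlib's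
`AddSubgroup.torsionBy.zmodModule` (supplied by `letI` in statements and proofs, as in
`ModPReducibilityProofs`; files that activate it as a local instance see the same terms):

* `WeierstrassCurve.trace_galoisRepTorsion_eq_toZMod_trace_galoisRepTate` — over any field `K`
  with `ℓ ≠ char K`: the trace of `σ ∈ Γ_K` on `E[ℓ]` is the reduction mod `ℓ` of its trace on
  the Tate module `T_ℓ E` (Silverman, *AEC*, III.§7: `T_ℓ E / ℓ T_ℓ E = E[ℓ]`; the images
  `P, Q ∈ E[ℓ]` of a `ℤ_ℓ`-basis of `T_ℓ E` form an `𝔽_ℓ`-basis of `E[ℓ]` — they span because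
  `T_ℓ E → E[ℓ]` is onto (`proj_surjective_of_isAlgClosed_holds`) and `#E[ℓ] = ℓ²`
  (`card_torsionPoints_eq_sq_holds`) — and `σ` acts on them through the reduction of its matrix,
  exactly as in `toZModPow_det_galoisRepTate_eq` of `TateModuleDeterminantProofs`);
* `WeierstrassCurve.trace_galoisRepTorsion_frobenius_eq` — **Serre's (238) for `n = ℓ`**: for a
  prime `p ≠ ℓ` of good reduction, a prime `𝔓` of `\bar ℤ` above `p` and an arithmetic Frobenius
  `σ` at `𝔓`, `tr(σ | E[ℓ]) = a_p mod ℓ` — from the tree's **theorem**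
  `trace_galoisRepTate_frobenius_eq_frobeniusTrace` (`IsogenyFrobeniusTraceProofs`, i.e.
  `trace_galoisRepTate_frobenius_of_hasGoodReductionAt_holds` of `HasseWeilGoodReductionProofs`:
  `tr(σ | T_ℓ E) = a_v = a_p`, Silverman C.21.3 via V.2.3.1, VII.4.1 and VII.1.3(b)) and the item
  above; with `galoisRepTorsion_eq_one_of_mem_inertia` (`GoodReductionUnramifiedProofs`,
  VII.4.1(a); prime-indexed here as `galoisRepTorsion_eq_one_of_mem_inertia_prime`) this is
  everything Chebotarev's theorem is applied to in Serre's argument (p. 124).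

## References

* [Serre1981] J.-P. Serre, *Quelques applications du théorème de densité de Chebotarev*, Publ.
  Math. IHÉS 54 (1981), §8.1, (238), p. 188.
* [SilvermanAEC2009] J. H. Silverman, *The Arithmetic of Elliptic Curves*, 2nd ed. (2009),
  III.§7, Prop. VII.1.3(b), Prop. VII.4.1, C.21 Remark 21.3.
-/

noncomputable section

open scoped Classical NumberField
open IsDedekindDomain Field

universe u

namespace WeierstrassCurve

open Literature.NumberTheory.EllipticCurves Literature.NumberTheory.GaloisRepresentations

section AnyField

variable {K : Type u} [Field K] (W : WeierstrassCurve K) (ℓ : ℕ) [Fact ℓ.Prime]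

/-- `x mod ℓ` computed by `PadicInt.toZModPow 1` and by `PadicInt.toZMod` agree (as natural
numbers `< ℓ`): the canonical representative `zmodRepr x` is `appr x 1`. [folklore] -/
theorem val_toZModPow_one_eq (x : ℤ_[ℓ]) :
    (PadicInt.toZModPow 1 x).val = (PadicInt.toZMod x).val := by
  have hp : ℓ.Prime := Fact.out
  have happr : x.zmodRepr = x.appr 1 :=
    PadicInt.zmodRepr_unique x _ (by simpa using PadicInt.appr_lt x 1)
      (by
        rw [PadicInt.maximalIdeal_eq_span_p, ← pow_one (ℓ : ℤ_[ℓ])]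
        exact PadicInt.appr_spec 1 x)
  rw [PadicInt.val_toZMod_eq_zmodRepr, happr]
  show ((x.appr 1 : ℕ) : ZMod (ℓ ^ 1)).val = x.appr 1
  rw [ZMod.val_natCast, Nat.mod_eq_of_lt (PadicInt.appr_lt x 1)]

/-- In the `𝔽_ℓ`-vector space `E[ℓ]`, the scalar `x mod ℓ` (`PadicInt.toZMod x`) acts as the
natural number `(PadicInt.toZModPow 1 x).val` — the coefficient appearing in
`TateModule.proj_smul`. [folklore] -/
theorem toZMod_smul_geomTorsion_eq (x : ℤ_[ℓ]) (Q : geomTorsion W ℓ) :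
    letI : Module (ZMod ℓ) (geomTorsion W ℓ) := AddSubgroup.torsionBy.zmodModule
    PadicInt.toZMod x • Q = (PadicInt.toZModPow 1 x).val • Q := by
  letI : Module (ZMod ℓ) (geomTorsion W ℓ) := AddSubgroup.torsionBy.zmodModule
  rw [val_toZModPow_one_eq, ← Nat.cast_smul_eq_nsmul (ZMod ℓ), ZMod.natCast_zmod_val]

/-- **The trace on `E[ℓ]` is the trace on `T_ℓ E` reduced mod `ℓ`.**  For an elliptic curve `E`
over a field `K`, a prime `ℓ ≠ char K` and `σ ∈ Γ_K`, the trace of `σ` acting `𝔽_ℓ`-linearly on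
`E[ℓ]` (`galoisRepTorsion`) is `PadicInt.toZMod` of the trace of `σ` on the Tate module `T_ℓ E`
(`galoisRepTate`): the images `P₀, P₁ ∈ E[ℓ]` of a `ℤ_ℓ`-basis of `T_ℓ E` form an `𝔽_ℓ`-basis of
`E[ℓ]` (they span since `T_ℓ E → E[ℓ]` is onto, and `#E[ℓ] = ℓ²`), in which `σ` acts through the
reduction of its `ℤ_ℓ`-matrix (Silverman, *AEC*, III.§7; the computation of
`toZModPow_det_galoisRepTate_eq` at level `1`, for the trace instead of the determinant).
[cite: SilvermanAEC2009, III.§7 (T_ℓ E and E[ℓ^n]) with Cor. III.6.4(b)] -/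
theorem trace_galoisRepTorsion_eq_toZMod_trace_galoisRepTate [W.IsElliptic] (hℓ : (ℓ : K) ≠ 0)
    (σ : absoluteGaloisGroup K) :
    letI : Module (ZMod ℓ) (geomTorsion W ℓ) := AddSubgroup.torsionBy.zmodModule
    LinearMap.trace (ZMod ℓ) (geomTorsion W ℓ)
        ((galoisRepTorsion W ℓ σ).toAdd.toAddMonoidHom.toZModLinearMap ℓ) =
      PadicInt.toZMod (LinearMap.trace ℤ_[ℓ] (W.tateModule ℓ) (W.galoisRepTate ℓ σ)) := by
  letI : Module (ZMod ℓ) (geomTorsion W ℓ) := AddSubgroup.torsionBy.zmodModule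
  have hp : ℓ.Prime := Fact.out
  haveI := module_free_tateModule_holds W ℓ
  haveI := module_finite_tateModule_holds W ℓ
  let b := Module.finBasisOfFinrankEq ℤ_[ℓ] (W.tateModule ℓ) (finrank_tateModule_eq_two_holds W ℓ hℓ)
  -- the images `P i ∈ E[ℓ]` of the basis vectors
  have hmem : ∀ i, TateModule.proj ℓ 1 (b i) ∈ geomTorsion W ℓ := fun i ↦ by
    simpa only [pow_one] using proj_tateModule_mem_geomTorsion W ℓ 1 (b i)
  let P : Fin 2 → geomTorsion W ℓ := fun i ↦ ⟨TateModule.proj ℓ 1 (b i), hmem i⟩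
  -- the `𝔽_ℓ`-linear map `(x₀, x₁) ↦ x₀ P₀ + x₁ P₁`
  let L : (Fin 2 → ZMod ℓ) →ₗ[ZMod ℓ] geomTorsion W ℓ := Fintype.linearCombination (ZMod ℓ) P
  have hL : ∀ c : Fin 2 → ZMod ℓ, L c = c 0 • P 0 + c 1 • P 1 := fun c ↦ by
    simp only [L, Fintype.linearCombination_apply, Fin.sum_univ_two]
  have hLcoe : ∀ x y : ℤ_[ℓ], ((L ![PadicInt.toZMod x, PadicInt.toZMod y] : geomTorsion W ℓ) :
      geomPoints W) = (PadicInt.toZModPow 1 x).val • TateModule.proj ℓ 1 (b 0) +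
        (PadicInt.toZModPow 1 y).val • TateModule.proj ℓ 1 (b 1) := fun x y ↦ by
    rw [hL]
    simp only [Matrix.cons_val_zero, Matrix.cons_val_one, Matrix.cons_val_fin_one]
    rw [toZMod_smul_geomTorsion_eq, toZMod_smul_geomTorsion_eq, AddSubgroup.coe_add,
      AddSubgroupClass.coe_nsmul, AddSubgroupClass.coe_nsmul]
  -- `L` is onto: `T_ℓ E → E[ℓ]` is onto and `a ↦ a_1` is `Σ (b.repr a i mod ℓ) (b i)_1`
  have hLsurj : Function.Surjective L := fun S ↦ by
    have hS : (S : geomPoints W) ∈ geomTorsion W (ℓ ^ 1 : ℕ) := by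
      simpa only [pow_one] using S.2
    obtain ⟨a, ha⟩ := proj_surjective_of_isAlgClosed_holds W ℓ 1 hS
    refine ⟨![PadicInt.toZMod (b.repr a 0), PadicInt.toZMod (b.repr a 1)], Subtype.ext ?_⟩
    rw [hLcoe, ← proj_eq_sum_repr W ℓ b a 1, ha]
  -- hence bijective, `#E[ℓ] = ℓ² = #𝔽_ℓ²`
  have hℓ' : (ℓ : AlgebraicClosure K) ≠ 0 := fun h ↦ hℓ <|
    (algebraMap K (AlgebraicClosure K)).injective (by rw [map_natCast, map_zero, h])
  haveI : Finite (geomTorsion W ℓ) :=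
    finite_torsionPoints_holds W (AlgebraicClosure K) (n := ℓ) (by exact_mod_cast hp.ne_zero)
  have hcardE : Nat.card (geomTorsion W ℓ) = ℓ ^ 2 :=
    card_torsionPoints_eq_sq_holds W (AlgebraicClosure K) (n := ℓ) hℓ'
  have hLbij : Function.Bijective L := by
    rw [Nat.bijective_iff_surjective_and_card]
    refine ⟨hLsurj, ?_⟩
    rw [hcardE, Nat.card_fun, Nat.card_eq_fintype_card, ZMod.card, Nat.card_eq_fintype_card,
      Fintype.card_fin]
  let e : geomTorsion W ℓ ≃ₗ[ZMod ℓ] (Fin 2 → ZMod ℓ) := (LinearEquiv.ofBijective L hLbij).symm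
  have he : ∀ c, e (L c) = c := fun c ↦ (LinearEquiv.ofBijective L hLbij).symm_apply_apply c
  let c : Module.Basis (Fin 2) (ZMod ℓ) (geomTorsion W ℓ) := Module.Basis.ofEquivFun e
  have hc : ∀ i, c i = P i := fun i ↦ by
    rw [Module.Basis.coe_ofEquivFun]
    show e.symm (Pi.single i 1) = P i
    rw [LinearEquiv.symm_apply_eq, ← he (Pi.single i 1)]
    congr 1
    simp only [L, Fintype.linearCombination_apply_single, one_smul]
  -- the matrix of `σ` on `T_ℓ E` and the action on the `P i`
  set M := LinearMap.toMatrix b b (W.galoisRepTate ℓ σ) with hMdef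
  set f := (galoisRepTorsion W ℓ σ).toAdd.toAddMonoidHom.toZModLinearMap ℓ with hfdef
  have hf : ∀ Q : geomTorsion W ℓ, f Q = σ • Q := fun Q ↦ rfl
  have hcol : ∀ j, σ • P j = L ![PadicInt.toZMod (M 0 j), PadicInt.toZMod (M 1 j)] := fun j ↦ by
    refine Subtype.ext ?_
    rw [AddSubgroup.torsionBy.coe_smul, hLcoe]
    show σ • TateModule.proj ℓ 1 (b j) = _
    have h1 : σ • TateModule.proj ℓ 1 (b j) = TateModule.proj ℓ 1 (W.galoisRepTate ℓ σ (b j)) := by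
      rw [galoisRepTate_apply_apply, TateModule.proj_smul_of_distribMulAction]
    rw [h1, proj_eq_sum_repr W ℓ b _ 1, hMdef, LinearMap.toMatrix_apply, LinearMap.toMatrix_apply]
  -- compute both traces in the bases `c` and `b`
  rw [LinearMap.trace_eq_matrix_trace (ZMod ℓ) c, LinearMap.trace_eq_matrix_trace ℤ_[ℓ] b, ← hMdef,
    Matrix.trace_fin_two, Matrix.trace_fin_two, map_add]
  have hentry : ∀ i, LinearMap.toMatrix c c f i i = PadicInt.toZMod (M i i) := fun i ↦ by
    rw [LinearMap.toMatrix_apply, hc, hf, hcol, Module.Basis.ofEquivFun_repr_apply, he]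
    fin_cases i <;> rfl
  rw [hentry 0, hentry 1]

end AnyField

section Rat

open NumberField Rat.HeightOneSpectrum

variable (W : WeierstrassCurve ℚ) [W.IsElliptic] [W.IsGloballyMinimal]

/-- **Serre 1981, (238), for `n = ℓ`: `Tr ρ̄_{E,ℓ}(σ_p) ≡ a_p (mod ℓ)`.**  Let `E = W/ℚ` be an
elliptic curve in global minimal form, `ℓ` a prime, `p ≠ ℓ` a prime of good reduction, `v` the
place of `ℚ` at `p`, `𝔓` a prime of `\bar ℤ` above `v` and `σ ∈ Γ_ℚ` an arithmetic Frobenius at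
`𝔓`.  Then the trace of `σ` on the `𝔽_ℓ`-plane `E[ℓ]` is `a_p mod ℓ`.  Proof: the trace on `E[ℓ]`
is the trace on `T_ℓ E` mod `ℓ` (`trace_galoisRepTorsion_eq_toZMod_trace_galoisRepTate`), the
latter is `a_v = a_p` (the tree's theorem `trace_galoisRepTate_frobenius_eq_frobeniusTrace`,
Silverman C.21.3 with VII.1.3(b)). [cite: Serre1981, §8.1 eq. (238) (p. 188)] -/
theorem trace_galoisRepTorsion_frobenius_eq (ℓ : ℕ) [Fact ℓ.Prime] {p : ℕ} [Fact p.Prime]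
    (hpℓ : p ≠ ℓ) (hgood : W.HasGoodReductionAtPrime p) {v : HeightOneSpectrum (𝓞 ℚ)}
    (hv : (primesEquiv v : ℕ) = p) {𝔓 : Ideal (absIntegers (𝓞 ℚ) ℚ)} (h𝔓 : 𝔓 ∈ v.primesAbove)
    {σ : absoluteGaloisGroup ℚ} (hσ : IsArithFrobAt (𝓞 ℚ) σ 𝔓) :
    letI : Module (ZMod ℓ) (geomTorsion W ℓ) := AddSubgroup.torsionBy.zmodModule
    LinearMap.trace (ZMod ℓ) (geomTorsion W ℓ)
        ((galoisRepTorsion W ℓ σ).toAdd.toAddMonoidHom.toZModLinearMap ℓ) =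
      (W.frobeniusTrace p : ZMod ℓ) := by
  letI : Module (ZMod ℓ) (geomTorsion W ℓ) := AddSubgroup.torsionBy.zmodModule
  have hℓ : ℓ.Prime := Fact.out
  have hne : (primesEquiv v : ℕ) ≠ ℓ := hv ▸ hpℓ
  have hgood' : W.HasGoodReductionAt v :=
    (hasGoodReductionAtPrime_primesEquiv_iff_holds W v p hv).mp hgood
  rw [trace_galoisRepTorsion_eq_toZMod_trace_galoisRepTate W ℓ (by exact_mod_cast hℓ.ne_zero) σ,
    W.trace_galoisRepTate_frobenius_eq_frobeniusTrace ℓ hne hgood' h𝔓 hσ, hv, map_intCast]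

/-- In particular, **at a good prime `p ≠ ℓ` with `a_p = 0` every arithmetic Frobenius above `p`
has trace `0` on `E[ℓ]`** — membership in Serre's class `C_ℓ = {tr = 0}` (1981, p. 124 and
p. 189). [cite: Serre1981, §8 proof of Thm. 20 (p. 189)] -/
theorem trace_galoisRepTorsion_frobenius_eq_zero (ℓ : ℕ) [Fact ℓ.Prime] {p : ℕ} [Fact p.Prime]
    (hpℓ : p ≠ ℓ) (hgood : W.HasGoodReductionAtPrime p) (hap : W.frobeniusTrace p = 0)
    {v : HeightOneSpectrum (𝓞 ℚ)} (hv : (primesEquiv v : ℕ) = p)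
    {𝔓 : Ideal (absIntegers (𝓞 ℚ) ℚ)} (h𝔓 : 𝔓 ∈ v.primesAbove)
    {σ : absoluteGaloisGroup ℚ} (hσ : IsArithFrobAt (𝓞 ℚ) σ 𝔓) :
    letI : Module (ZMod ℓ) (geomTorsion W ℓ) := AddSubgroup.torsionBy.zmodModule
    LinearMap.trace (ZMod ℓ) (geomTorsion W ℓ)
        ((galoisRepTorsion W ℓ σ).toAdd.toAddMonoidHom.toZModLinearMap ℓ) = 0 := by
  letI : Module (ZMod ℓ) (geomTorsion W ℓ) := AddSubgroup.torsionBy.zmodModule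
  rw [W.trace_galoisRepTorsion_frobenius_eq ℓ hpℓ hgood hv h𝔓 hσ, hap, Int.cast_zero]

omit [W.IsGloballyMinimal] in
/-- **`E[ℓ]` is unramified at a good prime `p ≠ ℓ`**, prime-indexed form of
`galoisRepTorsion_eq_one_of_mem_inertia` (`GoodReductionUnramifiedProofs`; Silverman, *AEC*,
Prop. VII.4.1(a)): `ρ̄_{E,ℓ}` kills the inertia group of every prime of `\bar ℤ` above `p`.
[cite: SilvermanAEC2009, Prop. VII.4.1(a)] -/
theorem galoisRepTorsion_eq_one_of_mem_inertia_prime (ℓ : ℕ) [Fact ℓ.Prime] {p : ℕ} [Fact p.Prime]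
    (hpℓ : p ≠ ℓ) (hgood : W.HasGoodReductionAtPrime p) {v : HeightOneSpectrum (𝓞 ℚ)}
    (hv : (primesEquiv v : ℕ) = p) {𝔓 : Ideal (absIntegers (𝓞 ℚ) ℚ)} (h𝔓 : 𝔓 ∈ v.primesAbove)
    {τ : absoluteGaloisGroup ℚ} (hτ : τ ∈ 𝔓.inertia (absoluteGaloisGroup ℚ)) :
    galoisRepTorsion W ℓ τ = 1 := by
  have hℓ : ℓ.Prime := Fact.out
  have hℓv : ((ℓ : ℤ) : 𝓞 ℚ) ∉ v.asIdeal := by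
    rw [Int.cast_natCast]
    exact natCast_not_mem_asIdeal_of_primesEquiv_ne hℓ (hv ▸ hpℓ)
  have hgood' : W.HasGoodReductionAt v := (hasGoodReductionAtPrime_primesEquiv_iff_holds W v p hv).mp hgood
  exact W.galoisRepTorsion_eq_one_of_mem_inertia hgood' hℓv h𝔓 hτ

end Rat

end WeierstrassCurve
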